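import Summits.ValiantsHypothesis.ValiantsHypothesis.Theorems.SymPencilPerFourInnerRankReducedFamily
import Summits.ValiantsHypothesis.ValiantsHypothesis.Theorems.SymPencilPerFourInnerRankPureGramP1
import Summits.ValiantsHypothesis.ValiantsHypothesis.Theorems.SymPencilSdcPerFourCellEightEight

/-!
# Route `SymPencil` — inner rank of the `2 | 2` row split of `per_4`: the identity is impossible on
# `≤ 11` squares AS SOON AS the PEELED reduced families are excluded (P1 consumed)
# (`--supports` stmt-ValiantsHypothesis-5674 `SdcSuperquadratic`; (8,8) column of the size tables;
# rung currency only — nothing here bears on `VP ≠ VNP`)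

This file composes three landed pieces and pins, by name and signature, the ONE remaining input of
the cells `(8, 8, 10)` (`m = 27`) and `(8, 8, 11)` (`m = 28`):

* `…InnerRankReducedFamily.exists_reduced_family` — every identity
  `Σ_r c_r t_r((a,b),(y₂,y₃))² = per (a; b; y₂; y₃)` with `|ι| ≤ 11` squares (characteristic `0`)
  yields a REDUCED family on `|κ| ≤ |ι|` squares: non-zero weights, the same identity, scalar outer
  blocks `t'((a,0),(x,0)) ∈ K v₀`, `t'((0,b),(0,x)) ∈ K v₀'`, and the reduced identity with the
  correction term `2 Σ c' t'((a,0),(y₂,0)) t'((0,b),(0,y₃))`;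
* **P1** `…PureGramP1.false_of_allX` — a PURE family (`t((a,0),(e_k,0)) = t((0,b),(0,e_k)) = 0`)
  needs at least twelve squares;
* `…SymPencilSdcPerFourCellEightEight.false_of_rank_eight_le_twentySeven_of_IR10` /
  `…twentyEight_of_IR11` — the two cells are empty modulo the inner-rank hypotheses IR10 / IR11.

**Theorem** (`false_of_peeled_hyp`).  If every PEELED reduced family on `≤ |ι|` squares — reduced
family data as produced by `exists_reduced_family` whose correction term is NOT identically zero,
the hypothesis shape of `…PeeledFactor.factor_of_peeled_ten` — is contradictory, then there is no
identity on `|ι| ≤ 11` squares at all: in the non-peeled case the pure part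
`t''((a,b),(y,z)) := t'((0,b),(y,0)) + t'((a,0),(0,z))` is a pure family for `per` itself
(`pure_of_correction_zero`) and P1 applies.  Corollaries: IR10 / IR11 follow from the peeled
hypotheses at `10` / `11` squares (`IR_of_peeled`), hence the cells `(8,8,10)` and
`(8,8,11)` are empty modulo «no peeled reduced family on `≤ 10` (resp. `≤ 11`) squares» ALONE
(`false_of_rank_eight_le_twentySeven_of_peeled_ten`, `…twentyEight_of_peeled_eleven`).

Honest framing: a CONDITIONAL closing — the peeled hypotheses are OPEN (at `|κ| = 10` a paper
proof exists, memo `NOTE-p6g16-5674-R2-peeled-ten.md`, Lean port `…Peeled*` in progress; `|κ| = 11`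
is open on paper); no cell closes here; the window `27 ≤ sdc(per_4) ≤ 29`, the crux
`SdcSuperquadratic` and `VP ≠ VNP` are untouched; no summit statement is proved.  No definitions,
no named facts. [folklore]
-/

noncomputable section

-- single-conjunct layout: Sub = Summit, duplicated namespace component intended
set_option linter.dupNamespace false

namespace Summit.ValiantsHypothesis.ValiantsHypothesis.Theorems.SymPencilPerFourInnerRankOfPeeled

open Matrix Finset Module MvPolynomial
open Literature.Computability.AlgebraicComplexity
open Summit.ValiantsHypothesis.ValiantsHypothesis.Theorems.SymPencilPerFourInnerRankReducedFamily
open Summit.ValiantsHypothesis.ValiantsHypothesis.Theorems.SymPencilPerFourInnerRankPureGramP1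
open Summit.ValiantsHypothesis.ValiantsHypothesis.Theorems.SymPencilSdcPerFourCellEightEight

universe u v

variable {K : Type u} [Field K]

/-! ### The non-peeled case is pure -/

/-- **Non-peeled ⇒ pure.**  If the outer blocks of a family are scalar (`t((a,0),(x,0)) ∈ K v₀`,
`t((0,b),(0,x)) ∈ K v₀'`) and the correction term `Σ c t((a,0),(y,0)) t((0,b),(0,z))` vanishes
identically, then the pure part `t''((a,b),(y,z)) := t((0,b),(y,0)) + t((a,0),(0,z))` is a PURE
family for `per (a; b; y; z)` with the same weights. [folklore] -/
theorem pure_of_correction_zero [CharZero K] {κ : Type v} [Fintype κ] (c : κ → K)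
    (t : κ → (((Fin 4 → K) × (Fin 4 → K)) →ₗ[K] ((Fin 4 → K) × (Fin 4 → K)) →ₗ[K] K))
    (hJ : ∀ a b y₂ y₃ : Fin 4 → K,
      ∑ r, c r * (t r (a, b) (y₂, y₃)) ^ 2 = (Matrix.of ![a, b, y₂, y₃]).permanent)
    (v₀ v₀' : κ → K) (hv₀ : ∀ (a x : Fin 4 → K), ∃ s : K, (fun r => t r (a, 0) (x, 0)) = s • v₀)
    (hv₀' : ∀ (b x : Fin 4 → K), ∃ s : K, (fun r => t r (0, b) (0, x)) = s • v₀')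
    (hzero : ∀ a b y z : Fin 4 → K, ∑ r, c r * t r (a, 0) (y, 0) * t r (0, b) (0, z) = 0) :
    ∃ t'' : κ → (((Fin 4 → K) × (Fin 4 → K)) →ₗ[K] ((Fin 4 → K) × (Fin 4 → K)) →ₗ[K] K),
      (∀ r (a b y z : Fin 4 → K), t'' r (a, b) (y, z) = t r (0, b) (y, 0) + t r (a, 0) (0, z)) ∧
      (∀ a b y₂ y₃ : Fin 4 → K,
        ∑ r, c r * (t'' r (a, b) (y₂, y₃)) ^ 2 = (Matrix.of ![a, b, y₂, y₃]).permanent) ∧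
      (∀ k : Fin 4, (∀ (a : Fin 4 → K) r, t'' r (a, 0) (Pi.single k 1, 0) = 0) ∧
        (∀ (b : Fin 4 → K) r, t'' r (0, b) (0, Pi.single k 1) = 0)) := by
  -- the two coordinate maps `(u₁,u₂) ↦ (u₁,0)` and `(u₁,u₂) ↦ (0,u₂)`
  let P₁ : ((Fin 4 → K) × (Fin 4 → K)) →ₗ[K] ((Fin 4 → K) × (Fin 4 → K)) :=
    (LinearMap.inl K (Fin 4 → K) (Fin 4 → K)).comp (LinearMap.fst K (Fin 4 → K) (Fin 4 → K))
  let P₂ : ((Fin 4 → K) × (Fin 4 → K)) →ₗ[K] ((Fin 4 → K) × (Fin 4 → K)) :=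
    (LinearMap.inr K (Fin 4 → K) (Fin 4 → K)).comp (LinearMap.snd K (Fin 4 → K) (Fin 4 → K))
  have hP₁ : ∀ u₁ u₂ : Fin 4 → K, P₁ (u₁, u₂) = (u₁, 0) := fun u₁ u₂ => rfl
  have hP₂ : ∀ u₁ u₂ : Fin 4 → K, P₂ (u₁, u₂) = (0, u₂) := fun u₁ u₂ => rfl
  let t'' : κ → (((Fin 4 → K) × (Fin 4 → K)) →ₗ[K] ((Fin 4 → K) × (Fin 4 → K)) →ₗ[K] K) :=
    fun r => (t r).compl₁₂ P₂ P₁ + (t r).compl₁₂ P₁ P₂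
  have ht'' : ∀ r (a b y z : Fin 4 → K), t'' r (a, b) (y, z) = t r (0, b) (y, 0) + t r (a, 0) (0, z) := by
    intro r a b y z
    simp only [t'', LinearMap.add_apply, LinearMap.compl₁₂_apply, hP₁, hP₂]
  have t00 : ∀ r (p : (Fin 4 → K) × (Fin 4 → K)), t r ((0 : Fin 4 → K), (0 : Fin 4 → K)) p = 0 :=
    fun r p => by rw [show ((0 : Fin 4 → K), (0 : Fin 4 → K)) = (0 : (Fin 4 → K) × (Fin 4 → K))
      from rfl, map_zero, LinearMap.zero_apply]
  have t00' : ∀ r (p : (Fin 4 → K) × (Fin 4 → K)), t r p ((0 : Fin 4 → K), (0 : Fin 4 → K)) = 0 :=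
    fun r p => by rw [show ((0 : Fin 4 → K), (0 : Fin 4 → K)) = (0 : (Fin 4 → K) × (Fin 4 → K))
      from rfl, map_zero]
  have hred := reduced_identity_of_scalar c t hJ v₀ v₀' hv₀ hv₀'
  refine ⟨t'', ht'', fun a b y₂ y₃ => ?_, fun k => ⟨fun a r => ?_, fun b r => ?_⟩⟩
  · simp_rw [ht'']
    rw [hred a b y₂ y₃, hzero a b y₂ y₃, mul_zero, sub_zero]
  · rw [ht'', t00, t00', add_zero]
  · rw [ht'', t00, t00', add_zero]

/-! ### No identity on `≤ 11` squares modulo the peeled reduced families -/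

/-- **The `2 | 2` split of `per_4` has no weighted sum-of-squares identity on `|ι| ≤ 11`
bilinear-by-bilinear squares, GIVEN that every PEELED reduced family on `≤ |ι|` squares is
contradictory** (characteristic `0`).  The hypothesis `HR2` is stated on exactly the data of
`exists_reduced_family` (cardinality bound, non-zero weights, joint identity, scalar outer blocks,
reduced identity) plus the peeled witness `∃ a b y z, Σ c t((a,0),(y,0)) t((0,b),(0,z)) ≠ 0`; the
non-peeled case is P1 (`…PureGramP1.false_of_allX`) via `pure_of_correction_zero`. [folklore] -/
theorem false_of_peeled_hyp [CharZero K] {ι : Type v} [Fintype ι] [DecidableEq ι]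
    (hι : Fintype.card ι ≤ 11)
    (HR2 : ∀ (κ : Type v) [Fintype κ] [DecidableEq κ], Fintype.card κ ≤ Fintype.card ι →
      ∀ (c : κ → K), (∀ r, c r ≠ 0) →
      ∀ (t : κ → (((Fin 4 → K) × (Fin 4 → K)) →ₗ[K] ((Fin 4 → K) × (Fin 4 → K)) →ₗ[K] K)),
      (∀ a b y₂ y₃ : Fin 4 → K,
        ∑ r, c r * (t r (a, b) (y₂, y₃)) ^ 2 = (Matrix.of ![a, b, y₂, y₃]).permanent) →
      ∀ (v₀ v₀' : κ → K),
      (∀ (a x : Fin 4 → K), ∃ s : K, (fun r => t r (a, 0) (x, 0)) = s • v₀) →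
      (∀ (b x : Fin 4 → K), ∃ s : K, (fun r => t r (0, b) (0, x)) = s • v₀') →
      (∀ a b y₂ y₃ : Fin 4 → K,
        ∑ r, c r * (t r (0, b) (y₂, 0) + t r (a, 0) (0, y₃)) ^ 2 =
          (Matrix.of ![a, b, y₂, y₃]).permanent
            - 2 * ∑ r, c r * t r (a, 0) (y₂, 0) * t r (0, b) (0, y₃)) →
      (∃ a b y z : Fin 4 → K, ∑ r, c r * t r (a, 0) (y, 0) * t r (0, b) (0, z) ≠ 0) → False)
    (c : ι → K)
    (t : ι → (((Fin 4 → K) × (Fin 4 → K)) →ₗ[K] ((Fin 4 → K) × (Fin 4 → K)) →ₗ[K] K))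
    (hJ : ∀ a b y₂ y₃ : Fin 4 → K,
      ∑ r, c r * (t r (a, b) (y₂, y₃)) ^ 2 = (Matrix.of ![a, b, y₂, y₃]).permanent) : False := by
  obtain ⟨κ, _, _, c', t', v₀, v₀', hκ, hc', hJ', hv₀, hv₀', hred⟩ := exists_reduced_family hι c t hJ
  by_cases hpeel : ∃ a b y z : Fin 4 → K, ∑ r, c' r * t' r (a, 0) (y, 0) * t' r (0, b) (0, z) ≠ 0
  · exact HR2 κ hκ c' hc' t' hJ' v₀ v₀' hv₀ hv₀' hred hpeel
  · push Not at hpeel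
    obtain ⟨t'', -, hJ'', hX''⟩ := pure_of_correction_zero c' t' hJ' v₀ v₀' hv₀ hv₀' hpeel
    exact false_of_allX (hκ.trans hι) c' t'' hJ'' hX''

/-- **IR at `d ≤ 11` squares from the peeled hypothesis at `d`**, in the exact shape of the
hypotheses `IR10` / `IR11` of `…SymPencilSdcPerFourCellEightEight` (index type `Fin d`).
[folklore] -/
theorem IR_of_peeled [CharZero K] {d : ℕ} (hd : d ≤ 11)
    (HR2 : ∀ (κ : Type) [Fintype κ] [DecidableEq κ], Fintype.card κ ≤ d →
      ∀ (c : κ → K), (∀ r, c r ≠ 0) →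
      ∀ (t : κ → (((Fin 4 → K) × (Fin 4 → K)) →ₗ[K] ((Fin 4 → K) × (Fin 4 → K)) →ₗ[K] K)),
      (∀ a b y₂ y₃ : Fin 4 → K,
        ∑ r, c r * (t r (a, b) (y₂, y₃)) ^ 2 = (Matrix.of ![a, b, y₂, y₃]).permanent) →
      ∀ (v₀ v₀' : κ → K),
      (∀ (a x : Fin 4 → K), ∃ s : K, (fun r => t r (a, 0) (x, 0)) = s • v₀) →
      (∀ (b x : Fin 4 → K), ∃ s : K, (fun r => t r (0, b) (0, x)) = s • v₀') →
      (∀ a b y₂ y₃ : Fin 4 → K,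
        ∑ r, c r * (t r (0, b) (y₂, 0) + t r (a, 0) (0, y₃)) ^ 2 =
          (Matrix.of ![a, b, y₂, y₃]).permanent
            - 2 * ∑ r, c r * t r (a, 0) (y₂, 0) * t r (0, b) (0, y₃)) →
      (∃ a b y z : Fin 4 → K, ∑ r, c r * t r (a, 0) (y, 0) * t r (0, b) (0, z) ≠ 0) → False) :
    ∀ (c : Fin d → K)
      (t : Fin d → (((Fin 4 → K) × (Fin 4 → K)) →ₗ[K] ((Fin 4 → K) × (Fin 4 → K)) →ₗ[K] K)),
      ¬ ∀ a b y₂ y₃ : Fin 4 → K,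
        ∑ r, c r * (t r (a, b) (y₂, y₃)) ^ 2 = (Matrix.of ![a, b, y₂, y₃]).permanent := by
  intro c t hJ
  have hι : Fintype.card (Fin d) ≤ 11 := by simpa using hd
  refine false_of_peeled_hyp hι (fun κ _ _ hκ => HR2 κ (hκ.trans (by simp))) c t hJ

/-! ### The two cells of the size tables modulo the peeled hypotheses alone -/

/-- **Cell `(8, 8, 10)` of `m = 27` is empty modulo «no peeled reduced family on `≤ 10` squares».**
(`…CellEightEight.false_of_rank_eight_le_twentySeven_of_IR10` with IR10 supplied by
`IR_of_peeled`, i.e. by P1 and the peeled hypothesis.)  The peeled hypothesis at ten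
squares is OPEN in the tree (paper proof: memo `NOTE-p6g16-5674-R2-peeled-ten.md`). [folklore] -/
theorem false_of_rank_eight_le_twentySeven_of_peeled_ten (K : Type*) [Field K] [CharZero K]
    {m : ℕ} (hm : m ≤ 27)
    {i₀ : Fin m} {D : Matrix {i // i ≠ i₀} {i // i ≠ i₀} K}
    {bL : (Fin 4 × Fin 4 → K) →ₗ[K] ({i // i ≠ i₀} → K)}
    {CL : (Fin 4 × Fin 4 → K) →ₗ[K] Matrix {i // i ≠ i₀} {i // i ≠ i₀} K} {κ₀ : K}
    (hD : IsUnit D.det) (hDs : Dᵀ = D) (hCs : ∀ z, (CL z)ᵀ = CL z) (hκ₀ : κ₀ ≠ 0)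
    (hi : ∀ z, bL z ⬝ᵥ D⁻¹ *ᵥ bL z = 0)
    (hii : ∀ z, bL z ⬝ᵥ (D⁻¹ * CL z * D⁻¹) *ᵥ bL z = 0)
    (hiii : ∀ z, D.det * (bL z ⬝ᵥ (D⁻¹ * CL z * D⁻¹ * CL z * D⁻¹) *ᵥ bL z) =
      -(κ₀ * eval z (perPoly (Fin 4) K)))
    (hV4 : ∀ x ∈ LinearMap.ker bL, ∀ r c : Fin 4,
      ((Matrix.of fun i j => x (i, j)).submatrix r.succAbove c.succAbove).permanent = 0)
    (hcard : Fintype.card {i // i ≠ i₀} + 1 = m)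
    (hrn : finrank K (LinearMap.range bL) + finrank K (LinearMap.ker bL) = 16)
    (HR2 : ∀ (κ : Type) [Fintype κ] [DecidableEq κ], Fintype.card κ ≤ 10 →
      ∀ (c : κ → K), (∀ r, c r ≠ 0) →
      ∀ (t : κ → (((Fin 4 → K) × (Fin 4 → K)) →ₗ[K] ((Fin 4 → K) × (Fin 4 → K)) →ₗ[K] K)),
      (∀ a b y₂ y₃ : Fin 4 → K,
        ∑ r, c r * (t r (a, b) (y₂, y₃)) ^ 2 = (Matrix.of ![a, b, y₂, y₃]).permanent) →
      ∀ (v₀ v₀' : κ → K),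
      (∀ (a x : Fin 4 → K), ∃ s : K, (fun r => t r (a, 0) (x, 0)) = s • v₀) →
      (∀ (b x : Fin 4 → K), ∃ s : K, (fun r => t r (0, b) (0, x)) = s • v₀') →
      (∀ a b y₂ y₃ : Fin 4 → K,
        ∑ r, c r * (t r (0, b) (y₂, 0) + t r (a, 0) (0, y₃)) ^ 2 =
          (Matrix.of ![a, b, y₂, y₃]).permanent
            - 2 * ∑ r, c r * t r (a, 0) (y₂, 0) * t r (0, b) (0, y₃)) →
      (∃ a b y z : Fin 4 → K, ∑ r, c r * t r (a, 0) (y, 0) * t r (0, b) (0, z) ≠ 0) → False)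
    (h8 : finrank K (LinearMap.range bL) = 8) : False :=
  false_of_rank_eight_le_twentySeven_of_IR10 K hm hD hDs hCs hκ₀ hi hii hiii hV4 hcard hrn
    (IR_of_peeled (by norm_num) HR2) h8

/-- **Cell `(8, 8, 11)` of `m = 28` is empty modulo «no peeled reduced family on `≤ 11` squares».**
(`…CellEightEight.false_of_rank_eight_le_twentyEight_of_IR11` with IR11 supplied by
`IR_of_peeled`.)  The peeled hypothesis at eleven squares is OPEN (also on paper).
[folklore] -/
theorem false_of_rank_eight_le_twentyEight_of_peeled_eleven (K : Type*) [Field K] [CharZero K]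
    {m : ℕ} (hm : m ≤ 28)
    {i₀ : Fin m} {D : Matrix {i // i ≠ i₀} {i // i ≠ i₀} K}
    {bL : (Fin 4 × Fin 4 → K) →ₗ[K] ({i // i ≠ i₀} → K)}
    {CL : (Fin 4 × Fin 4 → K) →ₗ[K] Matrix {i // i ≠ i₀} {i // i ≠ i₀} K} {κ₀ : K}
    (hD : IsUnit D.det) (hDs : Dᵀ = D) (hCs : ∀ z, (CL z)ᵀ = CL z) (hκ₀ : κ₀ ≠ 0)
    (hi : ∀ z, bL z ⬝ᵥ D⁻¹ *ᵥ bL z = 0)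
    (hii : ∀ z, bL z ⬝ᵥ (D⁻¹ * CL z * D⁻¹) *ᵥ bL z = 0)
    (hiii : ∀ z, D.det * (bL z ⬝ᵥ (D⁻¹ * CL z * D⁻¹ * CL z * D⁻¹) *ᵥ bL z) =
      -(κ₀ * eval z (perPoly (Fin 4) K)))
    (hV4 : ∀ x ∈ LinearMap.ker bL, ∀ r c : Fin 4,
      ((Matrix.of fun i j => x (i, j)).submatrix r.succAbove c.succAbove).permanent = 0)
    (hcard : Fintype.card {i // i ≠ i₀} + 1 = m)
    (hrn : finrank K (LinearMap.range bL) + finrank K (LinearMap.ker bL) = 16)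
    (HR2 : ∀ (κ : Type) [Fintype κ] [DecidableEq κ], Fintype.card κ ≤ 11 →
      ∀ (c : κ → K), (∀ r, c r ≠ 0) →
      ∀ (t : κ → (((Fin 4 → K) × (Fin 4 → K)) →ₗ[K] ((Fin 4 → K) × (Fin 4 → K)) →ₗ[K] K)),
      (∀ a b y₂ y₃ : Fin 4 → K,
        ∑ r, c r * (t r (a, b) (y₂, y₃)) ^ 2 = (Matrix.of ![a, b, y₂, y₃]).permanent) →
      ∀ (v₀ v₀' : κ → K),
      (∀ (a x : Fin 4 → K), ∃ s : K, (fun r => t r (a, 0) (x, 0)) = s • v₀) →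
      (∀ (b x : Fin 4 → K), ∃ s : K, (fun r => t r (0, b) (0, x)) = s • v₀') →
      (∀ a b y₂ y₃ : Fin 4 → K,
        ∑ r, c r * (t r (0, b) (y₂, 0) + t r (a, 0) (0, y₃)) ^ 2 =
          (Matrix.of ![a, b, y₂, y₃]).permanent
            - 2 * ∑ r, c r * t r (a, 0) (y₂, 0) * t r (0, b) (0, y₃)) →
      (∃ a b y z : Fin 4 → K, ∑ r, c r * t r (a, 0) (y, 0) * t r (0, b) (0, z) ≠ 0) → False)
    (h8 : finrank K (LinearMap.range bL) = 8) : False :=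
  false_of_rank_eight_le_twentyEight_of_IR11 K hm hD hDs hCs hκ₀ hi hii hiii hV4 hcard hrn
    (IR_of_peeled le_rfl HR2) h8

end Summit.ValiantsHypothesis.ValiantsHypothesis.Theorems.SymPencilPerFourInnerRankOfPeeled

end
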